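import Mathlib
import HarnessLib
import Summits.KontsevichZagierPeriods.Zeta5Search.SorokinParameterHolomorphy
import Summits.KontsevichZagierPeriods.Zeta5Search.SorokinCornerPerturb

/-!
# ζ(5) search — holomorphy of Zudilin's `J_k` in the parameter `h₀` (cell `pub-zeta5`, ct-1 g28)

HONEST FRAMING: systematic search; no irrationality claim unless kernel-certified.  A holomorphy statement for a parametric integral;
nothing here is an irrationality result, a worthiness exponent or a denominator statement; no named fact is discharged; no definition
is introduced.

Brick B6d (J-side) of `HOME/ct-1/g28/VWP-BLUEPRINT-g28.md` §3 (g): in Zudilin's parametrisation (4) the parameter `h₀` enters `J_k` only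
through `b_j = 1 + h₀ − h_{j+3}`.  From g27's `SorokinParameterHolomorphy.differentiableAt_line` (direction `u₀ = 0`, `u = 0`, `v ≡ 1`)
and `SorokinCornerPerturb.exists_integrable_perturb` (the `η`-room from the corner conditions):

* **`differentiableAt_shift`** — `w ↦ ∫_{[0,1]^k} ∏ x_j^{a_j−1}(1−x_j)^{(1+w−c_j)−a_j−1} Q_k^{−a₀} dx` is complex-differentiable at every `z` at
  which the corner conditions of `SorokinConvergence.integrableOn_sorokinIntegrand` hold for the real parts `(Re a₀; Re a_j | Re(1+z−c_j))`;
* `differentiableOn_shift` — hence holomorphic on any open set where they hold (the input of the identity theorem in `h₀`).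

Theorems only; imports `Zeta5Search/SorokinParameterHolomorphy`, `Zeta5Search/SorokinCornerPerturb`.
-/

noncomputable section

namespace Summit.KontsevichZagierPeriods.Zeta5Search.SorokinHolomorphyH0

open MeasureTheory Set Filter
open Literature.NumberTheory.Irrationality.Zudilin2002 (nestedQ sorokinIntegrand)
open Summit.KontsevichZagierPeriods.Zeta5Search.SorokinParameterHolomorphy (differentiableAt_line)
open Summit.KontsevichZagierPeriods.Zeta5Search.SorokinCornerPerturb (exists_integrable_perturb)

/-- **`J_k` is holomorphic in `h₀`**: for `k ≥ 1`, complex `a₀` (`Re a₀ ≥ 0`), `a_j`, `c_j`, and a point `z` at which the corner conditions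
hold for `(Re a₀; Re a_j | Re(1+z−c_j))` (edges `0 < Re a_j < Re(1+z−c_j)`, the mixed corners and, for odd `k`, the deepest corner),
`w ↦ ∫_{[0,1]^k} ∏_{j<k} x_j^{a_j−1}(1−x_j)^{(1+w−c_j)−a_j−1} · Q_k(x)^{−a₀} dx` is complex-differentiable at `z`. -/
theorem differentiableAt_shift {k : ℕ} (hk : 1 ≤ k) (a₀ : ℂ) (ha₀ : 0 ≤ a₀.re) (a c : ℕ → ℂ) (z : ℂ)
    (hE : ∀ j, j < k → 0 < (a j).re ∧ (a j).re < (1 + z - c j).re)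
    (hA : ∀ i, 2 * i + 2 ≤ k →
      a₀.re < (∑ m ∈ Finset.range (i + 1), ((1 + z - c (2 * m)).re - (a (2 * m)).re)) + (a (2 * i + 1)).re)
    (hAodd : Odd k → a₀.re < ∑ m ∈ Finset.range ((k + 1) / 2), ((1 + z - c (2 * m)).re - (a (2 * m)).re)) :
    DifferentiableAt ℂ (fun w : ℂ => ∫ x in Set.pi univ (fun _ : Fin k => Icc (0 : ℝ) 1),
      (∏ j : Fin k, ((x j : ℝ) : ℂ) ^ (a j - 1) * (1 - ((x j : ℝ) : ℂ)) ^ ((1 + w - c j) - a j - 1)) *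
        ((nestedQ (List.ofFn x) : ℝ) : ℂ) ^ (-a₀)) z := by
  -- the `η`-room
  obtain ⟨η, hη, hJη⟩ := exists_integrable_perturb hk ha₀ (fun n => (a n).re) (fun n => (1 + z - c n).re) hE hA hAodd
  -- differentiability of `t ↦ J(…, b_j + t)` at `t = 0`
  have hd := differentiableAt_line hk a₀ 0 a (fun n => 1 + z - c n) (fun _ => 0) (fun _ => 1) hη hJη
  simp only [mul_zero, add_zero, mul_one] at hd
  -- recenter: `w = z + t`
  have hcomp : (fun w : ℂ => ∫ x in Set.pi univ (fun _ : Fin k => Icc (0 : ℝ) 1),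
      (∏ j : Fin k, ((x j : ℝ) : ℂ) ^ (a j - 1) * (1 - ((x j : ℝ) : ℂ)) ^ ((1 + w - c j) - a j - 1)) *
        ((nestedQ (List.ofFn x) : ℝ) : ℂ) ^ (-a₀)) =
      (fun t : ℂ => ∫ x in Set.pi univ (fun _ : Fin k => Icc (0 : ℝ) 1),
        (∏ j : Fin k, ((x j : ℝ) : ℂ) ^ (a j - 1) * (1 - ((x j : ℝ) : ℂ)) ^ ((1 + z - c j + t) - a j - 1)) *
          ((nestedQ (List.ofFn x) : ℝ) : ℂ) ^ (-a₀)) ∘ fun w => w - z := by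
    funext w
    simp only [Function.comp]
    congr 1
    funext x
    congr 1
    refine Finset.prod_congr rfl fun j _ => ?_
    rw [show 1 + z - c j + (w - z) = 1 + w - c j by ring]
  rw [hcomp]
  refine DifferentiableAt.comp z ?_ (differentiableAt_id.sub_const z)
  simpa using hd

/-- **Holomorphy on an open set**: if the corner conditions hold at every point of an open set `U`, the same function is holomorphic on `U`. -/
theorem differentiableOn_shift {k : ℕ} (hk : 1 ≤ k) (a₀ : ℂ) (ha₀ : 0 ≤ a₀.re) (a c : ℕ → ℂ) {U : Set ℂ}
    (hE : ∀ z ∈ U, ∀ j, j < k → 0 < (a j).re ∧ (a j).re < (1 + z - c j).re)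
    (hA : ∀ z ∈ U, ∀ i, 2 * i + 2 ≤ k →
      a₀.re < (∑ m ∈ Finset.range (i + 1), ((1 + z - c (2 * m)).re - (a (2 * m)).re)) + (a (2 * i + 1)).re)
    (hAodd : ∀ z ∈ U, Odd k → a₀.re < ∑ m ∈ Finset.range ((k + 1) / 2), ((1 + z - c (2 * m)).re - (a (2 * m)).re)) :
    DifferentiableOn ℂ (fun w : ℂ => ∫ x in Set.pi univ (fun _ : Fin k => Icc (0 : ℝ) 1),
      (∏ j : Fin k, ((x j : ℝ) : ℂ) ^ (a j - 1) * (1 - ((x j : ℝ) : ℂ)) ^ ((1 + w - c j) - a j - 1)) *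
        ((nestedQ (List.ofFn x) : ℝ) : ℂ) ^ (-a₀)) U :=
  fun z hz => (differentiableAt_shift hk a₀ ha₀ a c z (hE z hz) (hA z hz) (hAodd z hz)).differentiableWithinAt

end Summit.KontsevichZagierPeriods.Zeta5Search.SorokinHolomorphyH0

end
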